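import Mathlib
import Literature.Algebra.GroupRings.UniqueProductWindow

/-!
# Diffuse groups, extremal points and ravels (Bowditch 2000)

B. H. Bowditch, *A variation on the unique product property*, J. London Math. Soc. (2) 62 (2000)
813–826, §§1–2 [cite: Bowditch2000]; recalled in S. Kionke, J. Raimbault, *On geometric aspects of
diffuse groups*, Doc. Math. 21 (2016) 873–915, §2.1 [cite: KionkeRaimbault2016].

For a group `G` and a finite subset `C ⊆ G`, an element `a ∈ C` is *extremal* in `C` if there is no
`g ≠ 1` with both `g a ∈ C` and `g⁻¹ a ∈ C`.  `G` is *diffuse* if every finite non-empty subset has an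
extremal element; a finite non-empty subset without extremal elements is called a *ravel*
([cite: KionkeRaimbault2016, §2.1]).  This file records the definitions and the elementary implications

* `not_isExtremal_iff` : `a ∈ C` is non-extremal iff `b a⁻¹ c = a` for some `b, c ∈ C` with `b ≠ a`;
* `isRavel_mul_of_no_uniqueMul` (Bowditch's lemma, [cite: Bowditch2000, §2], [cite: KionkeRaimbault2016,
  §2.2]): if no product of the non-empty finite sets `A`, `B` is uniquely represented, then `A * B` is a
  ravel; hence `Diffuse.uniqueProds` : diffuse groups have unique products, and the WINDOW form
  `uniqueProductWindow_of_forall_not_isRavel` used by the `pub-kaplansky` search: if a finite set `S`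
  contains no ravel then every window `(Sa, Sb)` with `Sa * Sb ⊆ S` is a unique-product window
  (`Literature.Algebra.GroupRings.UniqueProductWindow`), so there are no zero divisors supported on it;
* `diffuse_of_mulLeftStrictMono` : left-ordered groups are diffuse (the maximum of `C` is extremal),
  [cite: Bowditch2000, §1] (attributed there to Linnell–Witte Morris for the equivalence with weak
  diffuseness); contrapositively a group with a ravel is not left-orderable;
* `isRavel_image_of_witnesses` / `not_diffuse_of_witnesses` : a certificate format — a finite family
  `f : ι → G` with witness maps `j k : ι → ι`, `f (j i) ≠ f i` and `f (j i) (f i)⁻¹ f (k i) = f i`, is a ravel.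

The converse of Bowditch's lemma fails: a ravel need not come from a non-unique-product pair, and it is
an open question whether a non-diffuse torsion-free group must fail unique products
([cite: KionkeRaimbault2016, Question 1]).
-/

namespace Literature.GroupTheory.DiffuseGroups

open Literature.Algebra.GroupRings
open scoped Pointwise

variable {G : Type*} [Group G]

/-- `a` is an extremal point of the finite set `C`: `a ∈ C` and no `g ≠ 1` has both `g a ∈ C` and
`g⁻¹ a ∈ C`. [cite: Bowditch2000, §1] -/
def IsExtremal (C : Finset G) (a : G) : Prop :=
  a ∈ C ∧ ∀ g : G, g * a ∈ C → g⁻¹ * a ∈ C → g = 1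

/-- A ravel: a finite non-empty set none of whose elements is extremal.
[cite: KionkeRaimbault2016, §2.1] -/
def IsRavel (C : Finset G) : Prop :=
  C.Nonempty ∧ ∀ a ∈ C, ¬ IsExtremal C a

variable (G) in
/-- A diffuse group: every finite non-empty subset has an extremal point. [cite: Bowditch2000, §1] -/
def Diffuse : Prop :=
  ∀ C : Finset G, C.Nonempty → ∃ a ∈ C, IsExtremal C a

/-- A group is not diffuse iff it contains a ravel. [cite: KionkeRaimbault2016, §2.1] -/
theorem not_diffuse_iff_exists_isRavel : ¬ Diffuse G ↔ ∃ C : Finset G, IsRavel C := by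
  constructor
  · intro h
    by_contra hC
    apply h
    intro C hCne
    by_contra hno
    push Not at hno
    exact hC ⟨C, hCne, fun a ha hE => hno a ha hE⟩
  · rintro ⟨C, hCne, hC⟩ hD
    obtain ⟨a, ha, hE⟩ := hD C hCne
    exact hC a ha hE

/-- A ravel witnesses non-diffuseness. [cite: KionkeRaimbault2016, §2.1] -/
theorem IsRavel.not_diffuse {C : Finset G} (hC : IsRavel C) : ¬ Diffuse G :=
  not_diffuse_iff_exists_isRavel.mpr ⟨C, hC⟩

/-- Non-extremality of `a ∈ C` in terms of two other points of `C`: there are `b, c ∈ C`, `b ≠ a`,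
with `b a⁻¹ c = a` (take `b = g a`, `c = g⁻¹ a`; then automatically `c ≠ a`). [cite: Bowditch2000, §1] -/
theorem not_isExtremal_iff {C : Finset G} {a : G} (ha : a ∈ C) :
    ¬ IsExtremal C a ↔ ∃ b ∈ C, ∃ c ∈ C, b ≠ a ∧ b * a⁻¹ * c = a := by
  constructor
  · intro h
    unfold IsExtremal at h
    push Not at h
    obtain ⟨g, hga, hgia, hg⟩ := h ha
    refine ⟨g * a, hga, g⁻¹ * a, hgia, ?_, by group⟩
    intro hga'
    apply hg
    simpa using hga'
  · rintro ⟨b, hb, c, hc, hba, hbac⟩ ⟨_, hE⟩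
    have h1 : b * a⁻¹ * a ∈ C := by simpa using hb
    have h2 : (b * a⁻¹)⁻¹ * a ∈ C := by
      have : c = (b * a⁻¹)⁻¹ * a := eq_inv_mul_of_mul_eq hbac
      rw [← this]; exact hc
    have := hE (b * a⁻¹) h1 h2
    apply hba
    calc b = b * a⁻¹ * a := by group
      _ = a := by rw [this, one_mul]

/-- Bowditch's lemma: if `A`, `B` are finite and non-empty and no product in `A * B` is uniquely
represented, then `A * B` is a ravel.  (For `x = a b`, pick a second representation `x = a' b'` with
`a' ≠ a`; then `g := a' a⁻¹ ≠ 1` has `g x = a' b ∈ A B` and `g⁻¹ x = a b' ∈ A B`.)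
[cite: Bowditch2000, §2] [cite: KionkeRaimbault2016, §2.2] -/
theorem isRavel_mul_of_no_uniqueMul [DecidableEq G] {A B : Finset G} (hA : A.Nonempty)
    (hB : B.Nonempty) (h : ∀ a₀ ∈ A, ∀ b₀ ∈ B, ¬ UniqueMul A B a₀ b₀) : IsRavel (A * B) := by
  refine ⟨hA.mul hB, ?_⟩
  intro x hx
  obtain ⟨a, ha, b, hb, rfl⟩ := Finset.mem_mul.mp hx
  rw [not_isExtremal_iff hx]
  -- a second representation of `a * b`
  have hnu := h a ha b hb
  unfold UniqueMul at hnu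
  push Not at hnu
  obtain ⟨a', b', ha', hb', heq, hne⟩ := hnu
  have haa' : a' ≠ a := by
    intro haa
    subst haa
    exact hne rfl (mul_left_cancel heq)
  refine ⟨a' * b, Finset.mul_mem_mul ha' hb, a * b', Finset.mul_mem_mul ha hb', ?_, ?_⟩
  · intro h'
    exact haa' (mul_right_cancel h')
  · calc a' * b * (a * b)⁻¹ * (a * b') = a' * a⁻¹ * (a * b') := by group
      _ = a' * b' := by group
      _ = a * b := heq

/-- Hence a diffuse group has unique products. [cite: Bowditch2000, §2] -/
theorem Diffuse.uniqueProds [DecidableEq G] (hD : Diffuse G) : UniqueProds G := by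
  refine ⟨fun {A} {B} hA hB => ?_⟩
  by_contra hno
  push Not at hno
  exact (isRavel_mul_of_no_uniqueMul hA hB hno).not_diffuse hD

/-- Window form used by the `pub-kaplansky` search: if the finite set `S` contains no ravel, then every
window `(Sa, Sb)` with `Sa * Sb ⊆ S` has unique products (`UniqueProductWindow`), hence carries no zero
divisors over any field (`UniqueProductWindow.no_zero_divisors`). [cite: Bowditch2000, §2] -/
theorem uniqueProductWindow_of_forall_not_isRavel [DecidableEq G] {S Sa Sb : Finset G}
    (hS : ∀ C ⊆ S, ¬ IsRavel C) (hmul : Sa * Sb ⊆ S) : UniqueProductWindow Sa Sb := by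
  intro A hA B hB hAne hBne
  by_contra hno
  push Not at hno
  exact hS (A * B) ((Finset.mul_subset_mul hA hB).trans hmul)
    (isRavel_mul_of_no_uniqueMul hAne hBne hno)

/-- Left-ordered groups are diffuse: the maximum of `C` is an extremal point (if `g a, g⁻¹ a ≤ a` with
`g ≠ 1` then `g a < a` gives `a < g⁻¹ a` by left invariance).  [cite: Bowditch2000, §1] -/
theorem diffuse_of_mulLeftStrictMono [LinearOrder G] [MulLeftStrictMono G] : Diffuse G := by
  intro C hC
  refine ⟨C.max' hC, C.max'_mem hC, C.max'_mem hC, ?_⟩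
  intro g hga hgia
  by_contra hg
  set a := C.max' hC
  have h1 : g * a ≤ a := C.le_max' _ hga
  have h2 : g⁻¹ * a ≤ a := C.le_max' _ hgia
  have h1' : g * a < a := by
    refine lt_of_le_of_ne h1 ?_
    intro h
    exact hg (by simpa using h)
  have h3 : g⁻¹ * (g * a) < g⁻¹ * a := mul_lt_mul_right h1' g⁻¹
  rw [inv_mul_cancel_left] at h3
  exact absurd h2 (not_le.mpr h3)

/-- Contrapositive: a group containing a ravel admits no left-invariant linear order.
[cite: Bowditch2000, §1] -/
theorem IsRavel.not_mulLeftStrictMono [LinearOrder G] {C : Finset G} (hC : IsRavel C) :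
    ¬ MulLeftStrictMono G :=
  fun _ => hC.not_diffuse diffuse_of_mulLeftStrictMono

/-- Certificate format for a ravel: a finite non-empty family `f : ι → G` with witness maps `j k` such
that `f (j i) ≠ f i` and `f (j i) · (f i)⁻¹ · f (k i) = f i` for every `i`; then the image of `f` is a
ravel. [cite: KionkeRaimbault2016, §2.1] -/
theorem isRavel_image_of_witnesses [DecidableEq G] {ι : Type*} [Fintype ι] [Nonempty ι]
    (f : ι → G) (j k : ι → ι) (hne : ∀ i, f (j i) ≠ f i)
    (hw : ∀ i, f (j i) * (f i)⁻¹ * f (k i) = f i) :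
    IsRavel (Finset.univ.image f) := by
  refine ⟨Finset.univ_nonempty.image f, ?_⟩
  intro a ha
  obtain ⟨i, -, rfl⟩ := Finset.mem_image.mp ha
  rw [not_isExtremal_iff ha]
  exact ⟨f (j i), Finset.mem_image_of_mem f (Finset.mem_univ _), f (k i),
    Finset.mem_image_of_mem f (Finset.mem_univ _), hne i, hw i⟩

/-- … and therefore the group is not diffuse (and not left-orderable). [cite: KionkeRaimbault2016, §2.1] -/
theorem not_diffuse_of_witnesses {ι : Type*} [Fintype ι] [Nonempty ι]
    (f : ι → G) (j k : ι → ι) (hne : ∀ i, f (j i) ≠ f i)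
    (hw : ∀ i, f (j i) * (f i)⁻¹ * f (k i) = f i) : ¬ Diffuse G := by
  classical
  exact (isRavel_image_of_witnesses f j k hne hw).not_diffuse

/-- Subgroup version of the certificate: if the family takes values in a subgroup `H`, then `H` itself
is not diffuse. [cite: KionkeRaimbault2016, §2.1] -/
theorem not_diffuse_subgroup_of_witnesses {ι : Type*} [Fintype ι] [Nonempty ι] (H : Subgroup G)
    (f : ι → G) (hf : ∀ i, f i ∈ H) (j k : ι → ι) (hne : ∀ i, f (j i) ≠ f i)
    (hw : ∀ i, f (j i) * (f i)⁻¹ * f (k i) = f i) : ¬ Diffuse H := by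
  refine not_diffuse_of_witnesses (fun i => (⟨f i, hf i⟩ : H)) j k ?_ ?_
  · intro i h
    exact hne i (congrArg Subtype.val h)
  · intro i
    apply Subtype.ext
    simpa using hw i

/-- Ravels pass to overgroups along injective homomorphisms; equivalently diffuseness passes to
subgroups. [cite: Bowditch2000, §1] -/
theorem Diffuse.comap {H : Type*} [Group H] (φ : H →* G) (hφ : Function.Injective φ)
    (hD : Diffuse G) : Diffuse H := by
  classical
  intro C hC
  obtain ⟨a, ha, haE⟩ := hD (C.image φ) (hC.image φ)
  obtain ⟨x, hx, rfl⟩ := Finset.mem_image.mp ha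
  refine ⟨x, hx, hx, fun g hgx hgix => ?_⟩
  have := haE.2 (φ g) (by simpa using Finset.mem_image_of_mem φ hgx)
    (by simpa using Finset.mem_image_of_mem φ hgix)
  exact hφ (by simpa using this)

/-- In particular subgroups of diffuse groups are diffuse. [cite: Bowditch2000, §1] -/
theorem Diffuse.subgroup (hD : Diffuse G) (H : Subgroup G) : Diffuse H :=
  hD.comap H.subtype H.subtype_injective

end Literature.GroupTheory.DiffuseGroups
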